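import Literature.NumberTheory.Automorphic.GLnPlacesSplitting
import Literature.NumberTheory.Automorphic.IntegratedOperatorStar
import Literature.NumberTheory.Automorphic.LocalOperatorsProductNonvanishing
import HarnessLib

/-!
# `R_S(⊗_{v ∈ S} ξ_v) = ∏_{v ∈ S} R_v(ξ_v)`: the integrated operator of a pure tensor on
# `G_S = ∏_{v ∈ S} GL_n(K_v)` is the product of the local integrated operators
(Gelbart, *Automorphic forms on adele groups* (1975), §10, (10.11)–(10.13): `ξ_S = ⊗_{v ∈ S} f_v`,
`R(ξ_S ⊗ f) = (∏_{v ∈ S} R_v(f_v)) ∘ τ(f)`; Bump (1997), §3.3–3.4: the global Hecke algebra as a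
restricted tensor product of the local ones)

Topic `NumberTheory/Automorphic`; one bundled definition (`GLn.tensorCc`, the tensor
`⊗_{v ∈ S} ξ_v` as an element of `C_c(G_S)`) and theorems; no named fact, no global instance. For a
unitary strongly continuous representation `σ` of `GL_n(𝔸_K)` on a
Hilbert space, a finite set `S` of finite places, Haar measures `μ_v` on `GL_n(K_v)`,
`ξ_v ∈ C_c(GL_n(K_v))` and `Ξ ∈ C_c(G_S)` with `Ξ(x) = ∏_{v ∈ S} ξ_v(x_v)`:

  `(σ ∘ ι_S)(Ξ)` (with respect to `⊗_{v ∈ S} μ_v`) `= ∏_{v ∈ S} (σ ∘ ι_v)(ξ_v)`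

(`GLn.integratedOperator_toAdelicPi_eq_noncommProd`; the factors commute, the product is
`Finset.noncommProd` in any order). Induction on `S`: for `S = {a} ∪ T` the measurable
equivalence `G_{{a}} × G_T ≃ G_{{a} ∪ T}` (Mathlib's `MeasurableEquiv.piFinsetUnion`, measure
preserving for the product measures, `measurePreserving_piFinsetUnion`) splits the tensor
(`prod_piFinsetUnion`) and the embedding `ι_{{a} ∪ T} = ι_{{a}} · ι_T`
(`GLn.toAdelicPi_piFinsetUnion`); Fubini and `∫ ξ(b) σ(ι b) (∫ …) = σ|_ι(ξ) ∘ …` give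
`R_{{a} ∪ T} = R_{{a}} ∘ R_T`, and `G_{{a}} ≃ GL_n(K_a)` (`MeasurableEquiv.piUnique`) identifies
`R_{{a}}` with `R_a(ξ_a)` (`GLn.integratedOperator_toAdelicPi_singleton`). The empty product is the
Dirac measure (`Measure.pi_of_empty`), `R_∅ = 1`.

With `GLn.noncommProd_integratedOperator_toAdelic_ne_zero` (`LocalOperatorsProductNonvanishing`)
this gives `(σ ∘ ι_S)(⊗ ξ_v) ≠ 0` on an irreducible `σ` as soon as each `(σ ∘ ι_v)(ξ_v) ≠ 0`
(`GLn.integratedOperator_toAdelicPi_ne_zero`), the hypothesis of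
`GLn.exists_nhds_integratedOperator_placesTestFunction_ne_zero` (`GLnPlacesSplittingOperators`).
Part of the inline (D-0026) decomposition of
`Literature.NumberTheory.Automorphic.jacquetLanglands_transfer_surjective` (Gelbart Thm. 10.5 (ii)).

## References

* S. Gelbart, *Automorphic forms on adele groups*, Ann. of Math. Studies 83 (1975), §10,
  (10.11)–(10.13), p. 153 [Gelbart1975].
* D. Bump, *Automorphic Forms and Representations* (1997), §3.3–3.4 [Bump1997].
-/

noncomputable section

open MeasureTheory Measure Set Filter Topology IsDedekindDomain NumberField CompactlySupported
open scoped ENNReal NNReal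

namespace Literature.NumberTheory.Automorphic

/-! ### Finite products over the subtype of a finset -/

section Combinatorics

variable {α : Type*} [DecidableEq α]

/-- A product over the subtype `↥S` of a dependent family evaluated at a point of `∏_{v ∈ S} β v`
is the product over `S` of the family extended by `1`. [folklore] -/
theorem prod_univ_coe_eq_prod_dite {M : Type*} [CommMonoid M] (S : Finset α) {β : α → Type*}
    (x : ∀ v : S, β v) (f : ∀ a, β a → M) :
    ∏ v : S, f v (x v) = ∏ a ∈ S, (if h : a ∈ S then f a (x ⟨a, h⟩) else 1) := by
  rw [← Finset.prod_coe_sort S]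
  refine Finset.prod_congr rfl fun v _ => ?_
  rw [dif_pos v.2]

/-- The same for `Finset.noncommProd` (products in a fixed order of pairwise commuting elements).
[folklore] -/
theorem noncommProd_univ_coe_eq_noncommProd_dite {M : Type*} [Monoid M] (S : Finset α) {β : α → Type*}
    (x : ∀ v : S, β v) (f : ∀ a, β a → M)
    (comm : ((Finset.univ : Finset S) : Set S).Pairwise fun v w => Commute (f v (x v)) (f w (x w)))
    (comm' : (S : Set α).Pairwise fun a b =>
      Commute (if h : a ∈ S then f a (x ⟨a, h⟩) else 1) (if h : b ∈ S then f b (x ⟨b, h⟩) else 1)) :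
    (Finset.univ : Finset S).noncommProd (fun v => f v (x v)) comm =
      S.noncommProd (fun a => if h : a ∈ S then f a (x ⟨a, h⟩) else 1) comm' := by
  have key : ∀ (m₁ m₂ : Multiset M) (p₁ : {x | x ∈ m₁}.Pairwise Commute) (p₂ : {x | x ∈ m₂}.Pairwise Commute),
      m₁ = m₂ → m₁.noncommProd p₁ = m₂.noncommProd p₂ := by
    rintro m₁ _ p₁ p₂ rfl
    rfl
  refine key _ _ _ _ ?_
  rw [Finset.univ_eq_attach, Finset.attach_val,
    ← Multiset.attach_map_val' S.1 (fun a => if h : a ∈ S then f a (x ⟨a, h⟩) else 1)]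
  refine Multiset.map_congr rfl fun v _ => ?_
  rw [dif_pos v.2]

/-- **A tensor splits along `G_s × G_t ≃ G_{s ∪ t}`**: for disjoint `s`, `t` and the equivalence
`Equiv.piFinsetUnion`, `∏_{v ∈ s ∪ t} f_v((b ⊔ c)_v) = (∏_{v ∈ s} f_v(b_v)) (∏_{v ∈ t} f_v(c_v))`.
[folklore] -/
theorem prod_piFinsetUnion {M : Type*} [CommMonoid M] {β : α → Type*} {s t : Finset α}
    (h : Disjoint s t) (f : ∀ a, β a → M) (b : ∀ v : s, β v) (c : ∀ v : t, β v) :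
    ∏ v : ↥(s ∪ t), f v (Equiv.piFinsetUnion β h (b, c) v) =
      (∏ v : s, f v (b v)) * ∏ v : t, f v (c v) := by
  rw [prod_univ_coe_eq_prod_dite, prod_univ_coe_eq_prod_dite s, prod_univ_coe_eq_prod_dite t,
    Finset.prod_union h]
  congr 1
  · refine Finset.prod_congr rfl fun a ha => ?_
    rw [dif_pos (Finset.mem_union_left t ha), dif_pos ha, Equiv.piFinsetUnion_left β h ha]
  · refine Finset.prod_congr rfl fun a ha => ?_
    rw [dif_pos (Finset.mem_union_right s ha), dif_pos ha, Equiv.piFinsetUnion_right β h ha]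

end Combinatorics

/-! ### The local embeddings along `G_s × G_t ≃ G_{s ∪ t}` and `G_{{a}} ≃ GL_n(K_a)` -/

section Embeddings

variable {n : ℕ} {K : Type} [Field K] [NumberField K]

/-- The `1`-extended local embeddings `a ↦ ι_a(g_a)` (for `a ∈ U`) commute pairwise. [folklore] -/
theorem GLn.pairwise_commute_dite_toAdelic [DecidableEq (HeightOneSpectrum (𝓞 K))]
    (U : Finset (HeightOneSpectrum (𝓞 K)))
    (g : ∀ a, a ∈ U → GL (Fin n) (a.adicCompletion K)) (V : Set (HeightOneSpectrum (𝓞 K))) :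
    V.Pairwise fun a b => Commute (if h : a ∈ U then GLn.toAdelic n K a (g a h) else 1)
      (if h : b ∈ U then GLn.toAdelic n K b (g b h) else 1) := by
  intro a _ b _ hab
  by_cases ha : a ∈ U
  · by_cases hb : b ∈ U
    · rw [dif_pos ha, dif_pos hb]
      exact GLn.toAdelic_comm_of_ne hab _ _
    · rw [dif_neg hb]
      exact Commute.one_right _
  · rw [dif_neg ha]
    exact Commute.one_left _

/-- `ι_S(x) = ∏_{a ∈ S} ι_a(x_a)` as a product over the finset `S` of the `1`-extended family.
[folklore] -/
theorem GLn.toAdelicPi_eq_noncommProd_dite [DecidableEq (HeightOneSpectrum (𝓞 K))]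
    (S : Finset (HeightOneSpectrum (𝓞 K))) (x : GLn.LocalPi n K S) :
    GLn.toAdelicPi n K S x = S.noncommProd
      (fun a => if h : a ∈ S then GLn.toAdelic n K a (x ⟨a, h⟩) else 1)
      (GLn.pairwise_commute_dite_toAdelic S (fun a h => x ⟨a, h⟩) _) := by
  rw [GLn.toAdelicPi_apply]
  exact noncommProd_univ_coe_eq_noncommProd_dite
    (β := fun v : HeightOneSpectrum (𝓞 K) => GL (Fin n) (v.adicCompletion K)) S x
    (fun a y => GLn.toAdelic n K a y) _ _

/-- **`ι_{s ∪ t}(b ⊔ c) = ι_s(b) ι_t(c)`** along `Equiv.piFinsetUnion` for disjoint `s`, `t`.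
[folklore] -/
theorem GLn.toAdelicPi_piFinsetUnion [DecidableEq (HeightOneSpectrum (𝓞 K))]
    {s t : Finset (HeightOneSpectrum (𝓞 K))} (h : Disjoint s t)
    (b : GLn.LocalPi n K s) (c : GLn.LocalPi n K t) :
    GLn.toAdelicPi n K (s ∪ t)
        (Equiv.piFinsetUnion (fun v : HeightOneSpectrum (𝓞 K) => GL (Fin n) (v.adicCompletion K)) h (b, c)) =
      GLn.toAdelicPi n K s b * GLn.toAdelicPi n K t c := by
  rw [GLn.toAdelicPi_eq_noncommProd_dite, GLn.toAdelicPi_eq_noncommProd_dite,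
    GLn.toAdelicPi_eq_noncommProd_dite, Finset.noncommProd_union_of_disjoint h]
  congr 1
  · refine Finset.noncommProd_congr rfl (fun a ha => ?_) _
    rw [dif_pos (Finset.mem_union_left t ha), dif_pos ha, Equiv.piFinsetUnion_left _ h ha]
  · refine Finset.noncommProd_congr rfl (fun a ha => ?_) _
    rw [dif_pos (Finset.mem_union_right s ha), dif_pos ha, Equiv.piFinsetUnion_right _ h ha]

/-- `ι_{{a}}(x) = ι_a(x_a)`. [folklore] -/
theorem GLn.toAdelicPi_singleton (a : HeightOneSpectrum (𝓞 K)) (x : GLn.LocalPi n K {a}) :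
    GLn.toAdelicPi n K {a} x = GLn.toAdelic n K a (x ⟨a, Finset.mem_singleton_self a⟩) := by
  rw [GLn.toAdelicPi_apply, Finset.univ_unique, Finset.noncommProd_singleton]
  rfl

end Embeddings

/-! ### The integrated operator of a tensor on `G_S` -/

section Operators

variable {n : ℕ} {K : Type} [Field K] [NumberField K]
  {H : Type*} [NormedAddCommGroup H] [InnerProductSpace ℂ H] [CompleteSpace H]

attribute [local instance] adelicBorel borelSpace_adelic locallyCompactSpace_adelic
  secondCountableTopology_gl_adelic

/-- The product of Haar measures on `G_S` is a Haar measure, in particular finite on compact sets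
and σ-finite. [folklore] -/
theorem GLn.isFiniteMeasureOnCompacts_pi
    [∀ v : HeightOneSpectrum (𝓞 K), MeasurableSpace (GL (Fin n) (v.adicCompletion K))]
    [∀ v : HeightOneSpectrum (𝓞 K), BorelSpace (GL (Fin n) (v.adicCompletion K))]
    [∀ v : HeightOneSpectrum (𝓞 K), SecondCountableTopology (GL (Fin n) (v.adicCompletion K))]
    [∀ v : HeightOneSpectrum (𝓞 K), LocallyCompactSpace (GL (Fin n) (v.adicCompletion K))]
    (S : Finset (HeightOneSpectrum (𝓞 K)))
    (μ : ∀ v : HeightOneSpectrum (𝓞 K), Measure (GL (Fin n) (v.adicCompletion K)))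
    [∀ v, (μ v).IsHaarMeasure] :
    IsFiniteMeasureOnCompacts (Measure.pi fun v : S => μ v) := by
  haveI : T2Space (AdelicGroupData.gl n K).Adelic := t2Space_gl n K
  haveI : ∀ v : HeightOneSpectrum (𝓞 K), T2Space (GL (Fin n) (v.adicCompletion K)) := fun v =>
    T2Space.of_injective_continuous (f := GLn.toAdelic n K v) (GLn.toAdelic_injective)
      (GLn.continuous_toAdelic n K v)
  haveI : ∀ v : S, SigmaCompactSpace (GL (Fin n) ((v : HeightOneSpectrum (𝓞 K)).adicCompletion K)) :=
    fun v => sigmaCompactSpace_of_locallyCompact_secondCountable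
  haveI : ∀ v : S, SigmaFinite (μ v) := fun v => inferInstance
  haveI : BorelSpace (GLn.LocalPi n K S) := Pi.borelSpace
  haveI : (Measure.pi fun v : S => μ v).IsHaarMeasure := inferInstance
  infer_instance

/-- **The empty tensor**: `(σ ∘ ι_∅)(Ξ) = Ξ(·) • 1`, i.e. for `Ξ = ⊗_{v ∈ ∅} ξ_v = 1` the identity
(the product measure over the empty index set is the Dirac measure, `Measure.pi_of_empty`). [folklore] -/
theorem GLn.integratedOperator_toAdelicPi_empty
    [∀ v : HeightOneSpectrum (𝓞 K), MeasurableSpace (GL (Fin n) (v.adicCompletion K))]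
    [∀ v : HeightOneSpectrum (𝓞 K), BorelSpace (GL (Fin n) (v.adicCompletion K))]
    [∀ v : HeightOneSpectrum (𝓞 K), SecondCountableTopology (GL (Fin n) (v.adicCompletion K))]
    (σ : ContRepresentation ℂ (AdelicGroupData.gl n K).Adelic H)
    (hu' : (σ.restrict (GLn.toAdelicPi n K ∅)).IsUnitary)
    (hc' : (σ.restrict (GLn.toAdelicPi n K ∅)).IsStronglyContinuous)
    (μ : ∀ v : HeightOneSpectrum (𝓞 K), Measure (GL (Fin n) (v.adicCompletion K)))
    [IsFiniteMeasureOnCompacts (Measure.pi fun v : (∅ : Finset (HeightOneSpectrum (𝓞 K))) => μ v)]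
    (Ξ : C_c(GLn.LocalPi n K ∅, ℂ)) (hΞ : ∀ x, Ξ x = 1) :
    (σ.restrict (GLn.toAdelicPi n K ∅)).integratedOperator hu' hc' (Measure.pi fun v : (∅ : Finset _) => μ v) Ξ = 1 := by
  haveI : BorelSpace (GLn.LocalPi n K (∅ : Finset (HeightOneSpectrum (𝓞 K)))) := Pi.borelSpace
  ext w
  rw [ContRepresentation.integratedOperator_apply, Measure.pi_of_empty, integral_dirac]
  rw [hΞ, one_smul]
  change σ (GLn.toAdelicPi n K ∅ _) w = w
  have h1 : ∀ x : GLn.LocalPi n K (∅ : Finset (HeightOneSpectrum (𝓞 K))), x = 1 := fun x =>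
    funext fun v => (Finset.notMem_empty _ v.2).elim
  rw [h1 (isEmptyElim : GLn.LocalPi n K (∅ : Finset (HeightOneSpectrum (𝓞 K)))), map_one, map_one]
  rfl

/-- **The one-point tensor**: along `G_{{a}} ≃ GL_n(K_a)` (`MeasurableEquiv.piUnique`, measure
preserving for `⊗_{v ∈ {a}} μ_v` and `μ_a`), `(σ ∘ ι_{{a}})(Ξ) = (σ ∘ ι_a)(ξ_a)` for
`Ξ(x) = ξ_a(x_a)`. [folklore] -/
theorem GLn.integratedOperator_toAdelicPi_singleton
    [∀ v : HeightOneSpectrum (𝓞 K), MeasurableSpace (GL (Fin n) (v.adicCompletion K))]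
    [∀ v : HeightOneSpectrum (𝓞 K), BorelSpace (GL (Fin n) (v.adicCompletion K))]
    [∀ v : HeightOneSpectrum (𝓞 K), SecondCountableTopology (GL (Fin n) (v.adicCompletion K))]
    [∀ v : HeightOneSpectrum (𝓞 K), LocallyCompactSpace (GL (Fin n) (v.adicCompletion K))]
    (σ : ContRepresentation ℂ (AdelicGroupData.gl n K).Adelic H)
    (a : HeightOneSpectrum (𝓞 K))
    (hu' : (σ.restrict (GLn.toAdelicPi n K {a})).IsUnitary)
    (hc' : (σ.restrict (GLn.toAdelicPi n K {a})).IsStronglyContinuous)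
    (hu : (σ.restrict (GLn.toAdelic n K a)).IsUnitary)
    (hc : (σ.restrict (GLn.toAdelic n K a)).IsStronglyContinuous)
    (μ : ∀ v : HeightOneSpectrum (𝓞 K), Measure (GL (Fin n) (v.adicCompletion K)))
    [∀ v, (μ v).IsHaarMeasure]
    [IsFiniteMeasureOnCompacts (Measure.pi fun v : ({a} : Finset (HeightOneSpectrum (𝓞 K))) => μ v)]
    (ξ : C_c(GL (Fin n) (a.adicCompletion K), ℂ)) (Ξ : C_c(GLn.LocalPi n K {a}, ℂ))
    (hΞ : ∀ x, Ξ x = ξ (x ⟨a, Finset.mem_singleton_self a⟩)) :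
    (σ.restrict (GLn.toAdelicPi n K {a})).integratedOperator hu' hc'
        (Measure.pi fun v : ({a} : Finset _) => μ v) Ξ =
      (σ.restrict (GLn.toAdelic n K a)).integratedOperator hu hc (μ a) ξ := by
  haveI : T2Space (AdelicGroupData.gl n K).Adelic := t2Space_gl n K
  haveI : ∀ v : HeightOneSpectrum (𝓞 K), T2Space (GL (Fin n) (v.adicCompletion K)) := fun v =>
    T2Space.of_injective_continuous (f := GLn.toAdelic n K v) (GLn.toAdelic_injective)
      (GLn.continuous_toAdelic n K v)
  haveI : ∀ v : HeightOneSpectrum (𝓞 K), SigmaCompactSpace (GL (Fin n) (v.adicCompletion K)) :=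
    fun v => sigmaCompactSpace_of_locallyCompact_secondCountable
  haveI : ∀ v : ({a} : Finset (HeightOneSpectrum (𝓞 K))), SigmaFinite (μ v) := fun v => inferInstance
  ext w
  rw [ContRepresentation.integratedOperator_apply, ContRepresentation.integratedOperator_apply]
  -- transport along `piUnique`
  have hmp := (measurePreserving_piUnique
    (fun v : ({a} : Finset (HeightOneSpectrum (𝓞 K))) => μ v)).symm
  rw [← hmp.integral_comp (MeasurableEquiv.piUnique _).symm.measurableEmbedding]
  refine integral_congr_ae (Eventually.of_forall fun b => ?_)
  have hb : (MeasurableEquiv.piUnique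
      (fun v : ({a} : Finset (HeightOneSpectrum (𝓞 K))) => GL (Fin n) ((v : HeightOneSpectrum (𝓞 K)).adicCompletion K))).symm
        b ⟨a, Finset.mem_singleton_self a⟩ = b := by
    rw [MeasurableEquiv.piUnique_symm_apply]
    exact uniqueElim_default
      (α := fun v : ({a} : Finset (HeightOneSpectrum (𝓞 K))) => GL (Fin n) ((v : HeightOneSpectrum (𝓞 K)).adicCompletion K)) b
  change Ξ _ • σ (GLn.toAdelicPi n K {a} _) w = ξ b • σ (GLn.toAdelic n K a b) w
  rw [hΞ, GLn.toAdelicPi_singleton, hb]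

/-- **`R_{s ∪ t}(Ξ) = R_s(Ξ₁) ∘ R_t(Ξ₂)` for a tensor `Ξ(b ⊔ c) = Ξ₁(b) Ξ₂(c)`** along
`G_s × G_t ≃ G_{s ∪ t}` (disjoint `s`, `t`): change of variables (`measurePreserving_piFinsetUnion`),
Fubini, and `ι_{s ∪ t}(b ⊔ c) = ι_s(b) ι_t(c)`. [folklore] -/
theorem GLn.integratedOperator_toAdelicPi_union [DecidableEq (HeightOneSpectrum (𝓞 K))]
    [∀ v : HeightOneSpectrum (𝓞 K), MeasurableSpace (GL (Fin n) (v.adicCompletion K))]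
    [∀ v : HeightOneSpectrum (𝓞 K), BorelSpace (GL (Fin n) (v.adicCompletion K))]
    [∀ v : HeightOneSpectrum (𝓞 K), SecondCountableTopology (GL (Fin n) (v.adicCompletion K))]
    [∀ v : HeightOneSpectrum (𝓞 K), LocallyCompactSpace (GL (Fin n) (v.adicCompletion K))]
    (σ : ContRepresentation ℂ (AdelicGroupData.gl n K).Adelic H)
    {s t : Finset (HeightOneSpectrum (𝓞 K))} (h : Disjoint s t)
    (hu₀ : (σ.restrict (GLn.toAdelicPi n K (s ∪ t))).IsUnitary)
    (hc₀ : (σ.restrict (GLn.toAdelicPi n K (s ∪ t))).IsStronglyContinuous)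
    (hu₁ : (σ.restrict (GLn.toAdelicPi n K s)).IsUnitary)
    (hc₁ : (σ.restrict (GLn.toAdelicPi n K s)).IsStronglyContinuous)
    (hu₂ : (σ.restrict (GLn.toAdelicPi n K t)).IsUnitary)
    (hc₂ : (σ.restrict (GLn.toAdelicPi n K t)).IsStronglyContinuous)
    (μ : ∀ v : HeightOneSpectrum (𝓞 K), Measure (GL (Fin n) (v.adicCompletion K)))
    [∀ v, (μ v).IsHaarMeasure]
    [IsFiniteMeasureOnCompacts (Measure.pi fun v : ↥(s ∪ t) => μ v)]
    [IsFiniteMeasureOnCompacts (Measure.pi fun v : s => μ v)]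
    [IsFiniteMeasureOnCompacts (Measure.pi fun v : t => μ v)]
    (Ξ : C_c(GLn.LocalPi n K (s ∪ t), ℂ)) (Ξ₁ : C_c(GLn.LocalPi n K s, ℂ)) (Ξ₂ : C_c(GLn.LocalPi n K t, ℂ))
    (hΞ : ∀ b c, Ξ (Equiv.piFinsetUnion
      (fun v : HeightOneSpectrum (𝓞 K) => GL (Fin n) (v.adicCompletion K)) h (b, c)) = Ξ₁ b * Ξ₂ c) :
    (σ.restrict (GLn.toAdelicPi n K (s ∪ t))).integratedOperator hu₀ hc₀ (Measure.pi fun v : ↥(s ∪ t) => μ v) Ξ =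
      (σ.restrict (GLn.toAdelicPi n K s)).integratedOperator hu₁ hc₁ (Measure.pi fun v : s => μ v) Ξ₁ ∘L
        (σ.restrict (GLn.toAdelicPi n K t)).integratedOperator hu₂ hc₂ (Measure.pi fun v : t => μ v) Ξ₂ := by
  haveI : T2Space (AdelicGroupData.gl n K).Adelic := t2Space_gl n K
  haveI : ∀ v : HeightOneSpectrum (𝓞 K), T2Space (GL (Fin n) (v.adicCompletion K)) := fun v =>
    T2Space.of_injective_continuous (f := GLn.toAdelic n K v) (GLn.toAdelic_injective)
      (GLn.continuous_toAdelic n K v)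
  haveI : ∀ v : HeightOneSpectrum (𝓞 K), SigmaCompactSpace (GL (Fin n) (v.adicCompletion K)) :=
    fun v => sigmaCompactSpace_of_locallyCompact_secondCountable
  haveI : ∀ v : HeightOneSpectrum (𝓞 K), SigmaFinite (μ v) := fun v => inferInstance
  haveI : BorelSpace (GLn.LocalPi n K s) := Pi.borelSpace
  haveI : BorelSpace (GLn.LocalPi n K t) := Pi.borelSpace
  haveI : BorelSpace (GLn.LocalPi n K (s ∪ t)) := Pi.borelSpace
  haveI : BorelSpace (GLn.LocalPi n K s × GLn.LocalPi n K t) := Prod.borelSpace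
  -- the measurable equivalence and its continuity
  set β : HeightOneSpectrum (𝓞 K) → Type := fun v => GL (Fin n) (v.adicCompletion K) with hβ
  set e : GLn.LocalPi n K s × GLn.LocalPi n K t ≃ᵐ GLn.LocalPi n K (s ∪ t) :=
    MeasurableEquiv.piFinsetUnion β h with he
  have hmp : MeasurePreserving e ((Measure.pi fun v : s => μ v).prod (Measure.pi fun v : t => μ v))
      (Measure.pi fun v : ↥(s ∪ t) => μ v) := measurePreserving_piFinsetUnion h μ
  have he' : ∀ p, e p = Equiv.piFinsetUnion β h p := fun p => rfl
  -- the homeomorphism with the same underlying map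
  let eh : GLn.LocalPi n K s × GLn.LocalPi n K t ≃ₜ GLn.LocalPi n K (s ∪ t) :=
    (Homeomorph.sumPiEquivProdPi s t (fun b => β (Equiv.Finset.union s t h b))).symm.trans
      (Homeomorph.piCongrLeft (Y := fun v : ↥(s ∪ t) => β v) (Equiv.Finset.union s t h))
  have heh : ∀ p, eh p = e p := fun p => rfl
  ext w
  rw [ContinuousLinearMap.comp_apply, ContRepresentation.integratedOperator_apply,
    ContRepresentation.integratedOperator_apply, ← hmp.integral_comp e.measurableEmbedding]
  -- the integrand on the product is continuous with compact support, hence integrable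
  have hF : (fun p : GLn.LocalPi n K s × GLn.LocalPi n K t =>
      Ξ (e p) • (σ.restrict (GLn.toAdelicPi n K (s ∪ t))) (e p) w) =
      fun p => (Ξ₁ p.1 * Ξ₂ p.2) • σ (GLn.toAdelicPi n K s p.1) (σ (GLn.toAdelicPi n K t p.2) w) := by
    funext p
    rcases p with ⟨b, c⟩
    change Ξ (Equiv.piFinsetUnion β h (b, c)) • σ (GLn.toAdelicPi n K (s ∪ t) (Equiv.piFinsetUnion β h (b, c))) w = _
    rw [hΞ, GLn.toAdelicPi_piFinsetUnion h b c, map_mul, mul_apply_eq_comp]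
  rw [hF]
  have hcont : Continuous fun p : GLn.LocalPi n K s × GLn.LocalPi n K t =>
      (Ξ₁ p.1 * Ξ₂ p.2) • σ (GLn.toAdelicPi n K s p.1) (σ (GLn.toAdelicPi n K t p.2) w) := by
    have h1 : Continuous fun p : GLn.LocalPi n K s × GLn.LocalPi n K t =>
        σ (GLn.toAdelicPi n K s p.1 * GLn.toAdelicPi n K t p.2) w := by
      have := (hc₀ w)
      -- strong continuity of `σ ∘ ι_{s ∪ t}` transported along `eh`
      have h2 : (fun p : GLn.LocalPi n K s × GLn.LocalPi n K t =>
          σ (GLn.toAdelicPi n K s p.1 * GLn.toAdelicPi n K t p.2) w) =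
          fun p => (σ.restrict (GLn.toAdelicPi n K (s ∪ t))) (eh p) w := by
        funext p
        rcases p with ⟨b, c⟩
        change _ = σ (GLn.toAdelicPi n K (s ∪ t) (Equiv.piFinsetUnion β h (b, c))) w
        rw [GLn.toAdelicPi_piFinsetUnion h b c]
      rw [h2]
      exact this.comp eh.continuous
    have h1' : Continuous fun p : GLn.LocalPi n K s × GLn.LocalPi n K t =>
        σ (GLn.toAdelicPi n K s p.1) (σ (GLn.toAdelicPi n K t p.2) w) :=
      h1.congr fun p => by rw [map_mul, mul_apply_eq_comp]
    exact ((Ξ₁.continuous.comp continuous_fst).mul (Ξ₂.continuous.comp continuous_snd)).smul h1'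
  have hsupp : HasCompactSupport fun p : GLn.LocalPi n K s × GLn.LocalPi n K t =>
      (Ξ₁ p.1 * Ξ₂ p.2) • σ (GLn.toAdelicPi n K s p.1) (σ (GLn.toAdelicPi n K t p.2) w) := by
    refine HasCompactSupport.intro (Ξ₁.hasCompactSupport.isCompact.prod Ξ₂.hasCompactSupport.isCompact)
      fun p hp => ?_
    rw [Set.mem_prod, not_and_or] at hp
    rcases hp with hp | hp
    · rw [image_eq_zero_of_notMem_tsupport hp, zero_mul, zero_smul]
    · rw [image_eq_zero_of_notMem_tsupport hp, mul_zero, zero_smul]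
  have hint : Integrable (fun p : GLn.LocalPi n K s × GLn.LocalPi n K t =>
      (Ξ₁ p.1 * Ξ₂ p.2) • σ (GLn.toAdelicPi n K s p.1) (σ (GLn.toAdelicPi n K t p.2) w))
      ((Measure.pi fun v : s => μ v).prod (Measure.pi fun v : t => μ v)) :=
    hcont.integrable_of_hasCompactSupport hsupp
  rw [integral_prod _ hint]
  refine integral_congr_ae (Eventually.of_forall fun b => ?_)
  change ∫ c, (Ξ₁ b * Ξ₂ c) • σ (GLn.toAdelicPi n K s b) (σ (GLn.toAdelicPi n K t c) w) ∂(Measure.pi fun v : t => μ v) =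
    Ξ₁ b • (σ.restrict (GLn.toAdelicPi n K s)) b
      (∫ c, Ξ₂ c • (σ.restrict (GLn.toAdelicPi n K t)) c w ∂(Measure.pi fun v : t => μ v))
  rw [← ContinuousLinearMap.integral_comp_comm _ (ContRepresentation.integrable_smul_apply hc₂ _ Ξ₂ w),
    ← integral_smul]
  refine integral_congr_ae (Eventually.of_forall fun c => ?_)
  change (Ξ₁ b * Ξ₂ c) • σ (GLn.toAdelicPi n K s b) (σ (GLn.toAdelicPi n K t c) w) =
    Ξ₁ b • σ (GLn.toAdelicPi n K s b) (Ξ₂ c • σ (GLn.toAdelicPi n K t c) w)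
  rw [ContinuousLinearMap.map_smul, smul_smul]

/-- A tensor of compactly supported functions on a finite product has compact support (inside the
box `∏_v tsupport ξ_v`). [folklore] -/
theorem hasCompactSupport_tensor {ι : Type*} [Fintype ι] {β : ι → Type*} [∀ i, TopologicalSpace (β i)]
    (ξ : ∀ i, β i → ℂ) (hξ : ∀ i, HasCompactSupport (ξ i)) :
    HasCompactSupport fun x : (∀ i, β i) => ∏ i, ξ i (x i) := by
  refine HasCompactSupport.intro' (isCompact_univ_pi fun i => (hξ i).isCompact)
    (isClosed_set_pi fun i _ => isClosed_tsupport _) fun x hx => ?_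
  simp only [Set.mem_univ_pi, not_forall] at hx
  obtain ⟨i, hi⟩ := hx
  exact Finset.prod_eq_zero (Finset.mem_univ i) (image_eq_zero_of_notMem_tsupport hi)

/-- The tensor `⊗_{v ∈ S} ξ_v` as an element of `C_c(G_S)`. [folklore] -/
def GLn.tensorCc (S : Finset (HeightOneSpectrum (𝓞 K)))
    (ξ : ∀ v : HeightOneSpectrum (𝓞 K), C_c(GL (Fin n) (v.adicCompletion K), ℂ)) :
    C_c(GLn.LocalPi n K S, ℂ) :=
  ⟨⟨fun x => ∏ v : S, ξ v (x v),
    continuous_finsetProd _ fun v _ => (ξ (v : HeightOneSpectrum (𝓞 K))).continuous.comp (continuous_apply v)⟩,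
    hasCompactSupport_tensor (fun v : S => (ξ (v : HeightOneSpectrum (𝓞 K)) : _ → ℂ))
      fun v => (ξ (v : HeightOneSpectrum (𝓞 K))).hasCompactSupport⟩

/-- `tensorCc S ξ x = ∏_{v ∈ S} ξ_v(x_v)` (definitional). [folklore] -/
@[simp]
theorem GLn.tensorCc_apply (S : Finset (HeightOneSpectrum (𝓞 K)))
    (ξ : ∀ v : HeightOneSpectrum (𝓞 K), C_c(GL (Fin n) (v.adicCompletion K), ℂ)) (x : GLn.LocalPi n K S) :
    GLn.tensorCc S ξ x = ∏ v : S, ξ v (x v) := rfl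

/-- **`(σ ∘ ι_S)(⊗_{v ∈ S} ξ_v) = ∏_{v ∈ S} (σ ∘ ι_v)(ξ_v)`** (Gelbart (1975), (10.11)–(10.13):
`R_S(ξ_S) = ∏_{v ∈ S} R_v(f_v)` for `ξ_S = ⊗ f_v`). Data: `σ` a unitary strongly continuous
representation of `GL_n(𝔸_K)` on a Hilbert space; Haar measures `μ_v` on the `GL_n(K_v)`; a finite
set `S` of finite places; `ξ_v ∈ C_c(GL_n(K_v))` and `Ξ ∈ C_c(G_S)` with
`Ξ(x) = ∏_{v ∈ S} ξ_v(x_v)`. Then the integrated operator of `σ ∘ ι_S` at `Ξ` with respect to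
`⊗_{v ∈ S} μ_v` is the product, in any order, of the commuting local integrated operators
`(σ ∘ ι_v)(ξ_v)` (`Finset.noncommProd`; `GLn.pairwise_commute_integratedOperator_toAdelic`).
Induction on `S` through `GLn.integratedOperator_toAdelicPi_union/_singleton/_empty`.
[cite: Gelbart1975, (10.11)–(10.13)] -/
theorem GLn.integratedOperator_toAdelicPi_eq_noncommProd
    [∀ v : HeightOneSpectrum (𝓞 K), MeasurableSpace (GL (Fin n) (v.adicCompletion K))]
    [∀ v : HeightOneSpectrum (𝓞 K), BorelSpace (GL (Fin n) (v.adicCompletion K))]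
    [∀ v : HeightOneSpectrum (𝓞 K), SecondCountableTopology (GL (Fin n) (v.adicCompletion K))]
    [∀ v : HeightOneSpectrum (𝓞 K), LocallyCompactSpace (GL (Fin n) (v.adicCompletion K))]
    (σ : ContRepresentation ℂ (AdelicGroupData.gl n K).Adelic H) (hu : σ.IsUnitary) (hc : σ.IsStronglyContinuous)
    (μ : ∀ v : HeightOneSpectrum (𝓞 K), Measure (GL (Fin n) (v.adicCompletion K)))
    [∀ v, (μ v).IsHaarMeasure]
    (ξ : ∀ v : HeightOneSpectrum (𝓞 K), C_c(GL (Fin n) (v.adicCompletion K), ℂ))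
    (S : Finset (HeightOneSpectrum (𝓞 K)))
    (hu' : (σ.restrict (GLn.toAdelicPi n K S)).IsUnitary)
    (hc' : (σ.restrict (GLn.toAdelicPi n K S)).IsStronglyContinuous)
    [IsFiniteMeasureOnCompacts (Measure.pi fun v : S => μ v)]
    (huv : ∀ v, (σ.restrict (GLn.toAdelic n K v)).IsUnitary)
    (hcv : ∀ v, (σ.restrict (GLn.toAdelic n K v)).IsStronglyContinuous)
    (Ξ : C_c(GLn.LocalPi n K S, ℂ)) (hΞ : ∀ x, Ξ x = ∏ v : S, ξ v (x v))
    (comm : (S : Set (HeightOneSpectrum (𝓞 K))).Pairwise fun v w =>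
      Commute ((σ.restrict (GLn.toAdelic n K v)).integratedOperator (huv v) (hcv v) (μ v) (ξ v))
        ((σ.restrict (GLn.toAdelic n K w)).integratedOperator (huv w) (hcv w) (μ w) (ξ w))) :
    (σ.restrict (GLn.toAdelicPi n K S)).integratedOperator hu' hc' (Measure.pi fun v : S => μ v) Ξ =
      S.noncommProd (fun v => (σ.restrict (GLn.toAdelic n K v)).integratedOperator (huv v) (hcv v) (μ v) (ξ v)) comm := by
  classical
  -- the statement for all finsets, by induction
  suffices key : ∀ (T : Finset (HeightOneSpectrum (𝓞 K)))
      (huT : (σ.restrict (GLn.toAdelicPi n K T)).IsUnitary)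
      (hcT : (σ.restrict (GLn.toAdelicPi n K T)).IsStronglyContinuous)
      (_ : IsFiniteMeasureOnCompacts (Measure.pi fun v : T => μ v))
      (Θ : C_c(GLn.LocalPi n K T, ℂ)) (_ : ∀ x, Θ x = ∏ v : T, ξ v (x v))
      (commT : (T : Set (HeightOneSpectrum (𝓞 K))).Pairwise fun v w =>
        Commute ((σ.restrict (GLn.toAdelic n K v)).integratedOperator (huv v) (hcv v) (μ v) (ξ v))
          ((σ.restrict (GLn.toAdelic n K w)).integratedOperator (huv w) (hcv w) (μ w) (ξ w))),
      @ContRepresentation.integratedOperator _ _ _ _ _ _ _ _ _ (σ.restrict (GLn.toAdelicPi n K T)) huT hcT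
          (Measure.pi fun v : T => μ v) ‹_› Θ =
        T.noncommProd (fun v => (σ.restrict (GLn.toAdelic n K v)).integratedOperator (huv v) (hcv v) (μ v) (ξ v))
          commT from
    key S hu' hc' inferInstance Ξ hΞ comm
  intro T
  induction T using Finset.induction_on with
  | empty =>
    intro huT hcT _ Θ hΘ commT
    rw [Finset.noncommProd_empty]
    refine GLn.integratedOperator_toAdelicPi_empty σ huT hcT μ Θ fun x => ?_
    rw [hΘ x]
    exact Fintype.prod_empty _
  | @insert a T haT ih =>
    have hdisj : Disjoint ({a} : Finset (HeightOneSpectrum (𝓞 K))) T :=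
      Finset.disjoint_singleton_left.2 haT
    rw [Finset.insert_eq a T]
    intro huT hcT hfin Θ hΘ commT
    -- data over `{a}` and over `T`
    haveI : IsFiniteMeasureOnCompacts (Measure.pi fun v : ({a} : Finset (HeightOneSpectrum (𝓞 K))) => μ v) :=
      GLn.isFiniteMeasureOnCompacts_pi {a} μ
    haveI hfinT : IsFiniteMeasureOnCompacts (Measure.pi fun v : T => μ v) := GLn.isFiniteMeasureOnCompacts_pi T μ
    have hu₁ : (σ.restrict (GLn.toAdelicPi n K {a})).IsUnitary := hu.restrict _
    have hc₁ : (σ.restrict (GLn.toAdelicPi n K {a})).IsStronglyContinuous :=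
      hc.restrict _ (GLn.continuous_toAdelicPi n K {a})
    have hu₂ : (σ.restrict (GLn.toAdelicPi n K T)).IsUnitary := hu.restrict _
    have hc₂ : (σ.restrict (GLn.toAdelicPi n K T)).IsStronglyContinuous :=
      hc.restrict _ (GLn.continuous_toAdelicPi n K T)
    -- `Θ` is the tensor of the tensors over `{a}` and over `T`
    have hΘ' : ∀ b c, Θ (Equiv.piFinsetUnion
        (fun v : HeightOneSpectrum (𝓞 K) => GL (Fin n) (v.adicCompletion K)) hdisj (b, c)) =
        GLn.tensorCc {a} ξ b * GLn.tensorCc T ξ c := by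
      intro b c
      rw [hΘ, GLn.tensorCc_apply, GLn.tensorCc_apply]
      exact prod_piFinsetUnion (β := fun v : HeightOneSpectrum (𝓞 K) => GL (Fin n) (v.adicCompletion K)) hdisj
        (fun v y => ξ v y) b c
    rw [GLn.integratedOperator_toAdelicPi_union σ hdisj huT hcT hu₁ hc₁ hu₂ hc₂ μ Θ
      (GLn.tensorCc {a} ξ) (GLn.tensorCc T ξ) hΘ']
    -- the factor over `T` by induction, the factor over `{a}` by the one-point lemma
    rw [ih hu₂ hc₂ hfinT (GLn.tensorCc T ξ) (fun x => rfl) (commT.mono (Finset.coe_subset.2 Finset.subset_union_right)),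
      GLn.integratedOperator_toAdelicPi_singleton σ a hu₁ hc₁ (huv a) (hcv a) μ (ξ a) (GLn.tensorCc {a} ξ)
        (fun x => ?_)]
    · rw [Finset.noncommProd_union_of_disjoint hdisj, Finset.noncommProd_singleton]
      rfl
    · rw [GLn.tensorCc_apply, Fintype.prod_unique]
      rfl

/-- The product identity for the bundled tensor `GLn.tensorCc S ξ`. [cite: Gelbart1975, (10.11)–(10.13)] -/
theorem GLn.integratedOperator_toAdelicPi_tensorCc_eq_noncommProd
    [∀ v : HeightOneSpectrum (𝓞 K), MeasurableSpace (GL (Fin n) (v.adicCompletion K))]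
    [∀ v : HeightOneSpectrum (𝓞 K), BorelSpace (GL (Fin n) (v.adicCompletion K))]
    [∀ v : HeightOneSpectrum (𝓞 K), SecondCountableTopology (GL (Fin n) (v.adicCompletion K))]
    [∀ v : HeightOneSpectrum (𝓞 K), LocallyCompactSpace (GL (Fin n) (v.adicCompletion K))]
    (σ : ContRepresentation ℂ (AdelicGroupData.gl n K).Adelic H) (hu : σ.IsUnitary) (hc : σ.IsStronglyContinuous)
    (μ : ∀ v : HeightOneSpectrum (𝓞 K), Measure (GL (Fin n) (v.adicCompletion K)))
    [∀ v, (μ v).IsHaarMeasure]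
    (ξ : ∀ v : HeightOneSpectrum (𝓞 K), C_c(GL (Fin n) (v.adicCompletion K), ℂ))
    (S : Finset (HeightOneSpectrum (𝓞 K)))
    (hu' : (σ.restrict (GLn.toAdelicPi n K S)).IsUnitary)
    (hc' : (σ.restrict (GLn.toAdelicPi n K S)).IsStronglyContinuous)
    [IsFiniteMeasureOnCompacts (Measure.pi fun v : S => μ v)]
    (huv : ∀ v, (σ.restrict (GLn.toAdelic n K v)).IsUnitary)
    (hcv : ∀ v, (σ.restrict (GLn.toAdelic n K v)).IsStronglyContinuous)
    (comm : (S : Set (HeightOneSpectrum (𝓞 K))).Pairwise fun v w =>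
      Commute ((σ.restrict (GLn.toAdelic n K v)).integratedOperator (huv v) (hcv v) (μ v) (ξ v))
        ((σ.restrict (GLn.toAdelic n K w)).integratedOperator (huv w) (hcv w) (μ w) (ξ w))) :
    (σ.restrict (GLn.toAdelicPi n K S)).integratedOperator hu' hc' (Measure.pi fun v : S => μ v) (GLn.tensorCc S ξ) =
      S.noncommProd (fun v => (σ.restrict (GLn.toAdelic n K v)).integratedOperator (huv v) (hcv v) (μ v) (ξ v)) comm :=
  GLn.integratedOperator_toAdelicPi_eq_noncommProd σ hu hc μ ξ S hu' hc' huv hcv _ (fun _ => rfl) comm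

/-- **`(σ ∘ ι_S)(⊗_{v ∈ S} ξ_v) ≠ 0` on an irreducible `σ` once each `(σ ∘ ι_v)(ξ_v) ≠ 0`** (Gelbart
(1975), pp. 151–153: the fixed ramified factor `R(ξ_S)` of the test functions `ξ_S ⊗ f` does not
annihilate a constituent with the prescribed local components) — the product identity combined
with `GLn.noncommProd_integratedOperator_toAdelic_ne_zero` (`LocalOperatorsProductNonvanishing`).
This is the hypothesis `hΞ` of `GLn.exists_nhds_integratedOperator_placesTestFunction_ne_zero`
(`GLnPlacesSplittingOperators`). [cite: Gelbart1975, §10 pp. 151–153] -/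
theorem GLn.integratedOperator_toAdelicPi_tensorCc_ne_zero
    [∀ v : HeightOneSpectrum (𝓞 K), MeasurableSpace (GL (Fin n) (v.adicCompletion K))]
    [∀ v : HeightOneSpectrum (𝓞 K), BorelSpace (GL (Fin n) (v.adicCompletion K))]
    [∀ v : HeightOneSpectrum (𝓞 K), SecondCountableTopology (GL (Fin n) (v.adicCompletion K))]
    [∀ v : HeightOneSpectrum (𝓞 K), LocallyCompactSpace (GL (Fin n) (v.adicCompletion K))]
    (σ : ContRepresentation ℂ (AdelicGroupData.gl n K).Adelic H) (hσ : σ.IsTopIrreducible)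
    (hu : σ.IsUnitary) (hc : σ.IsStronglyContinuous)
    (μ : ∀ v : HeightOneSpectrum (𝓞 K), Measure (GL (Fin n) (v.adicCompletion K)))
    [∀ v, (μ v).IsHaarMeasure]
    (ξ : ∀ v : HeightOneSpectrum (𝓞 K), C_c(GL (Fin n) (v.adicCompletion K), ℂ))
    (S : Finset (HeightOneSpectrum (𝓞 K))) (hS : S.Nonempty)
    (hu' : (σ.restrict (GLn.toAdelicPi n K S)).IsUnitary)
    (hc' : (σ.restrict (GLn.toAdelicPi n K S)).IsStronglyContinuous)
    [IsFiniteMeasureOnCompacts (Measure.pi fun v : S => μ v)]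
    (huv : ∀ v, (σ.restrict (GLn.toAdelic n K v)).IsUnitary)
    (hcv : ∀ v, (σ.restrict (GLn.toAdelic n K v)).IsStronglyContinuous)
    (h0 : ∀ v ∈ S, (σ.restrict (GLn.toAdelic n K v)).integratedOperator (huv v) (hcv v) (μ v) (ξ v) ≠ 0) :
    (σ.restrict (GLn.toAdelicPi n K S)).integratedOperator hu' hc' (Measure.pi fun v : S => μ v) (GLn.tensorCc S ξ) ≠ 0 := by
  rw [GLn.integratedOperator_toAdelicPi_tensorCc_eq_noncommProd σ hu hc μ ξ S hu' hc' huv hcv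
    (GLn.pairwise_commute_integratedOperator_toAdelic σ huv hcv μ ξ _)]
  exact GLn.noncommProd_integratedOperator_toAdelic_ne_zero σ hσ huv hcv μ ξ S hS _ h0

end Operators

end Literature.NumberTheory.Automorphic
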